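import Mathlib
import Literature.AlgebraicGeometry.HyperbolicPolynomials.CompressionDeterminant
import Literature.Analysis.Convex.SpectralConeLift

/-!
# PermanentalConeHard (stmt-ValiantsHypothesis-8654) — the compression model in a general positive direction (infrastructure for the no-go stub_twoRowsNotWitness, lead c3)

Route `PermanentalCones` of `ValiantsHypothesis`, crux `PermanentalConeHard`, line `registered`
(the `r = 2` no-go wave).  Saunderson–Parrilo / Sanyal: for an `(n+1) × n` matrix `V` with
orthonormal columns spanning `𝟙^⊥` (`Vᵀ V = I`, `V Vᵀ = I - 𝟙𝟙ᵀ/(n+1)`) one has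
`e_n(x) = (n+1) · det(Vᵀ diag(x) V)` (`e_n` the `n`-th elementary symmetric polynomial in `n+1`
variables).  The lead needs this determinantal model along a general positive direction `a > 0`
instead of `𝟙`:

* `B := Vᵀ diag(a) V ≻ 0` (`Vᵀ V = I` makes `x ↦ V x` injective), so there is an invertible `T`
  with `Tᵀ B T = I` (`T = W diag(β)^{-1/2}` for an orthogonal diagonalisation `B = W diag(β) Wᵀ`);
* `Vᵀ diag(y + u a) V = A_y + u B`, hence `Tᵀ (A_y + u B) T = M(y) + u I` with `M(y) = Tᵀ A_y T`;
  if `M(y) = U diag(d) Uᵀ` with `U` orthogonal then `det(M(y) + u I) = ∏ⱼ (u + dⱼ)`;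
* therefore `e_n(y + u a) = (n+1) det(A_y + u B) = (n+1) det(T)⁻² ∏ⱼ (u + dⱼ)`,
  i.e. the conclusion of `stub_compressionCongruence` with `c = (n+1) / det(T)²`.

Everything here is proved in full from the tree files
`Literature/AlgebraicGeometry/HyperbolicPolynomials/CompressionDeterminant`
(`esymm_eigenvalues_compression`, `det_smul_one_add_conj_diagonal`) and
`Literature/Analysis/Convex/SpectralConeLift` (`exists_orthogonal_conj_diagonal`).

References: J. Saunderson, P. A. Parrilo, *Polynomial-sized semidefinite representations of
derivative relaxations of spectrahedral cones*, Math. Program. 153 (2015) 309–331, §2 and Lemma 1.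
-/

set_option linter.dupNamespace false

noncomputable section

namespace Summit.ValiantsHypothesis.ValiantsHypothesis.Theorems.PermanentalConesPermanentalConeHard

open Matrix Finset
open scoped BigOperators Matrix
open Literature.AlgebraicGeometry.HyperbolicPolynomials Literature.Analysis.Convex

namespace TwoRowsCongruence

/-- `e_n` in `n` variables is the product of all the variables. [folklore] -/
theorem esymm_fin_card (n : ℕ) :
    MvPolynomial.esymm (Fin n) ℝ n = ∏ i : Fin n, (MvPolynomial.X i : MvPolynomial (Fin n) ℝ) := by
  have h := Finset.powersetCard_self (Finset.univ : Finset (Fin n))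
  rw [Finset.card_univ, Fintype.card_fin] at h
  rw [MvPolynomial.esymm, h, Finset.sum_singleton]

/-- `e_n(d) = ∏ᵢ dᵢ` for `d ∈ ℝⁿ`. [folklore] -/
theorem eval_esymm_fin_card (n : ℕ) (d : Fin n → ℝ) :
    MvPolynomial.eval d (MvPolynomial.esymm (Fin n) ℝ n) = ∏ i, d i := by
  rw [esymm_fin_card, MvPolynomial.eval_prod]
  simp only [MvPolynomial.eval_X]

/-- `det (U diag(d) Uᵀ) = ∏ⱼ dⱼ` for `U Uᵀ = I`. [folklore] -/
theorem det_conj_diagonal {m : Type*} [Fintype m] [DecidableEq m] {U : Matrix m m ℝ}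
    (hU : U * Uᵀ = 1) (d : m → ℝ) : det (U * diagonal d * Uᵀ) = ∏ j, d j := by
  simpa only [zero_smul, zero_add] using det_smul_one_add_conj_diagonal hU d 0

/-- A matrix `W diag(β) Wᵀ` with `W Wᵀ = I` and `β > 0` is congruent to the identity through an
invertible matrix (`T = W diag(β)^{-1/2}`). [folklore] -/
theorem exists_congruent_one_conj_diagonal {m : Type*} [Fintype m] [DecidableEq m]
    {W : Matrix m m ℝ} (hW : W * Wᵀ = 1) {β : m → ℝ} (hβ : ∀ i, 0 < β i) :
    ∃ T : Matrix m m ℝ, IsUnit T.det ∧ Tᵀ * (W * diagonal β * Wᵀ) * T = 1 := by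
  have hWtW : Wᵀ * W = 1 := mul_eq_one_comm.1 hW
  have hsqrt : ∀ i, 0 < Real.sqrt (β i) := fun i => Real.sqrt_pos.2 (hβ i)
  refine ⟨W * diagonal fun i => (Real.sqrt (β i))⁻¹, ?_, ?_⟩
  · rw [det_mul, det_diagonal, isUnit_iff_ne_zero]
    refine mul_ne_zero (fun h0 => ?_) (Finset.prod_ne_zero_iff.2 fun i _ => (inv_pos.2 (hsqrt i)).ne')
    have h := congrArg det hW
    rw [det_mul, det_transpose, h0, zero_mul, det_one] at h
    exact zero_ne_one h
  · rw [transpose_mul, diagonal_transpose]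
    have hassoc : (diagonal fun i => (Real.sqrt (β i))⁻¹) * Wᵀ * (W * diagonal β * Wᵀ) *
        (W * diagonal fun i => (Real.sqrt (β i))⁻¹) =
          (diagonal fun i => (Real.sqrt (β i))⁻¹) * (Wᵀ * W) * diagonal β *
            ((Wᵀ * W) * diagonal fun i => (Real.sqrt (β i))⁻¹) := by
      simp only [Matrix.mul_assoc]
    rw [hassoc, hWtW, Matrix.mul_one, Matrix.one_mul, diagonal_mul_diagonal, diagonal_mul_diagonal,
      ← diagonal_one]
    congr 1
    funext i
    rw [mul_comm ((Real.sqrt (β i))⁻¹) (β i), mul_assoc, ← mul_inv, Real.mul_self_sqrt (hβ i).le,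
      mul_inv_cancel₀ (hβ i).ne']

/-- A positive definite real matrix is congruent to the identity through an invertible matrix.
[folklore] -/
theorem exists_congruent_one {m : Type*} [Fintype m] [DecidableEq m] {B : Matrix m m ℝ}
    (hB : B.PosDef) : ∃ T : Matrix m m ℝ, IsUnit T.det ∧ Tᵀ * B * T = 1 := by
  obtain ⟨W, hW, hBW⟩ := exists_orthogonal_conj_diagonal hB.1
  obtain ⟨T, hT⟩ := exists_congruent_one_conj_diagonal hW hB.eigenvalues_pos
  rw [← hBW] at hT
  exact ⟨T, hT⟩

variable {n : ℕ} {V : Matrix (Fin (n + 1)) (Fin n) ℝ}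

/-- The compression `Vᵀ diag(x) V` of a diagonal matrix is symmetric. [folklore] -/
theorem isHermitian_compression (V : Matrix (Fin (n + 1)) (Fin n) ℝ) (x : Fin (n + 1) → ℝ) :
    (Vᵀ * diagonal x * V).IsHermitian := by
  have h := isHermitian_conjTranspose_mul_mul V (isHermitian_diagonal x)
  rwa [conjTranspose_eq_transpose_of_trivial] at h

/-- `Vᵀ V = I` makes `x ↦ V x` injective. [folklore] -/
theorem mulVec_injective_of_transpose_mul_self (hVtV : Vᵀ * V = 1) :
    Function.Injective V.mulVec := by
  intro x₁ x₂ h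
  have h' := congrArg Vᵀ.mulVec h
  simpa only [mulVec_mulVec, hVtV, one_mulVec] using h'

/-- `Vᵀ diag(a) V ≻ 0` for `a > 0` and `Vᵀ V = I`. [folklore] -/
theorem posDef_compression (hVtV : Vᵀ * V = 1) {a : Fin (n + 1) → ℝ} (ha : ∀ j, 0 < a j) :
    (Vᵀ * diagonal a * V).PosDef := by
  have h := (Matrix.PosDef.diagonal ha).conjTranspose_mul_mul_same
    (mulVec_injective_of_transpose_mul_self hVtV)
  rwa [conjTranspose_eq_transpose_of_trivial] at h

/-- **Saunderson–Parrilo, `e_n` as a compression determinant**: for `V Vᵀ = I - 𝟙𝟙ᵀ/(n+1)`,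
`e_n(x) = (n+1) · det(Vᵀ diag(x) V)` (Lemma 1 at `t = 0`, here read off from the coefficient
identity `(n+1) eₙ(λ(Vᵀ diag(x) V)) = e_n(x)`). [cite: SaundersonParrilo2014, Lemma 1] -/
theorem eval_esymm_eq_det_compression
    (hV : V * Vᵀ = 1 - ((n : ℝ) + 1)⁻¹ • Matrix.of (fun _ _ => (1 : ℝ))) (x : Fin (n + 1) → ℝ) :
    MvPolynomial.eval x (MvPolynomial.esymm (Fin (n + 1)) ℝ n) =
      ((n : ℝ) + 1) * det (Vᵀ * diagonal x * V) := by
  obtain ⟨U, hU, hd⟩ := exists_orthogonal_conj_diagonal (isHermitian_compression V x)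
  have h := esymm_eigenvalues_compression hV x hU hd le_rfl
  rw [eval_esymm_fin_card, ← det_conj_diagonal hU (isHermitian_compression V x).eigenvalues,
    ← hd] at h
  linear_combination -h

/-- The pencil along `a` after the congruence: `Tᵀ Vᵀ diag(y + u a) V T = u I + Tᵀ Vᵀ diag(y) V T`
when `Tᵀ (Vᵀ diag(a) V) T = I`. [folklore] -/
theorem congruence_pencil {T : Matrix (Fin n) (Fin n) ℝ} {a : Fin (n + 1) → ℝ}
    (hT : Tᵀ * (Vᵀ * diagonal a * V) * T = 1) (y : Fin (n + 1) → ℝ) (u : ℝ) :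
    Tᵀ * (Vᵀ * diagonal (y + u • a) * V) * T =
      u • (1 : Matrix (Fin n) (Fin n) ℝ) + Tᵀ * (Vᵀ * diagonal y * V) * T := by
  have hdiag : diagonal (y + u • a) = diagonal y + u • diagonal a := by
    rw [← diagonal_smul, diagonal_add]
    rfl
  rw [hdiag]
  simp only [Matrix.mul_add, Matrix.add_mul, Matrix.mul_smul, Matrix.smul_mul]
  rw [hT, add_comm]

end TwoRowsCongruence

open TwoRowsCongruence in
/-- **The compression model in a general positive direction.**  For `V` with `Vᵀ V = I`,
`V Vᵀ = I - 𝟙𝟙ᵀ/(n+1)` and `a > 0`: there are an invertible `T` with `Tᵀ (Vᵀ diag(a) V) T = I` and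
`c > 0` (`c = (n+1)/det(T)²`) such that, whenever `Tᵀ (Vᵀ diag(y) V) T = U diag(d) Uᵀ` with `U`
orthogonal, `e_n(y + u a) = c ∏ⱼ (u + dⱼ)` for all `u`. [cite: SaundersonParrilo2014, Lemma 1] -/
theorem stub_compressionCongruence : ∀ (n : ℕ) (V : Matrix (Fin (n + 1)) (Fin n) ℝ), V.transpose * V = 1 → V * V.transpose = 1 - ((n : ℝ) + 1)⁻¹ • Matrix.of (fun _ _ => (1 : ℝ)) → ∀ (a : Fin (n + 1) → ℝ), (∀ j, 0 < a j) → ∃ (T : Matrix (Fin n) (Fin n) ℝ) (c : ℝ), 0 < c ∧ IsUnit T.det ∧ T.transpose * (V.transpose * Matrix.diagonal a * V) * T = 1 ∧ ∀ (y : Fin (n + 1) → ℝ) (u : ℝ) (U : Matrix (Fin n) (Fin n) ℝ) (d : Fin n → ℝ), U * U.transpose = 1 → T.transpose * (V.transpose * Matrix.diagonal y * V) * T = U * Matrix.diagonal d * U.transpose → MvPolynomial.eval (y + u • a) (MvPolynomial.esymm (Fin (n + 1)) ℝ n) = c * ∏ j, (u + d j) := by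
  intro n V hVtV hVVt a ha
  obtain ⟨T, hTdet, hT⟩ := exists_congruent_one (posDef_compression hVtV ha)
  have hdT : T.det ≠ 0 := hTdet.ne_zero
  refine ⟨T, ((n : ℝ) + 1) / T.det ^ 2, div_pos (by positivity) (by positivity), hTdet, hT, ?_⟩
  intro y u U d hU hM
  have hdet : det (Tᵀ * (Vᵀ * diagonal (y + u • a) * V) * T) = ∏ j, (u + d j) := by
    rw [congruence_pencil hT y u, hM, det_smul_one_add_conj_diagonal hU d u]
  rw [det_mul, det_mul, det_transpose] at hdet
  rw [eval_esymm_eq_det_compression hVVt, ← hdet, div_mul_eq_mul_div, eq_div_iff (pow_ne_zero 2 hdT)]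
  ring

end Summit.ValiantsHypothesis.ValiantsHypothesis.Theorems.PermanentalConesPermanentalConeHard

end
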